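import Literature.AlgebraicGeometry.Motives.HodgeStructureCentralizerEquivariantFormsPoints
import HarnessLib

/-!
# Milne's involution `β ↦ β†` of `End_K(V(A) ⊗ K)` for `e_D = Q_K` ("`e_D(βx, y) = e_D(x, β†y)`"), and the LITERAL point
# descriptions `S(A)(K) = {γ ∈ C(A) ⊗ K | γ†γ = 1}`, `G(A)(K) = {γ ∈ C(A) ⊗ K | γ†γ ∈ K^×}`; Prop. 1.3 with parity over `K`
# (Milne 1999 §1 p. 642 L64–L74, p. 643 L5–L6 and L41–L42, p. 644 L16–L20; §4 p. 659 L10–L17), on the abstract polarized `ℚ`-HS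

[topic AlgebraicGeometry/Motives]

Layer `Literature/AlgebraicGeometry/Motives`, lane `lit-hodgefound` (Track 2 foundations library; seat `lit-hodgefound-p34`,
generation 20, self-proposed row g20-#5 of `run/shared/lean/pub/lit-hodgefound/SKELETON.md`). The seat's g18-#1
`Motives/HodgeStructureLefschetzGroupPoints` has Milne's `†` only over `ℚ` (`Polarization.adjoint`, `S(H)(ℚ) = {γ†γ = 1}`
literally: `mem_lefschetzGroup_iff_adjoint_mul_self_eq_one`) and defines the `K`-points `S(H)(K)`, `G(H)(K)` through
"`γ` preserves `Q_K`" / "`Q_K(γx, γy) = ν Q_K(x, y)`"; g18-#8 `Motives/HodgeStructureCentralizerEquivariantFormsPoints` proves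
Prop. 1.3 over `K` WITHOUT its parity clause (no `†` on `End_K(K ⊗ V)` in the tree). This file supplies the missing object —
ONE DEFINITION WITH BODY, `Polarization.adjointBaseChange K Q β = β†`, Mathlib's `leftAdjointOfNondegenerate` for the
non-degenerate form `Q_K = Q.form.baseChange K` (g18-#8's `Polarization.baseChange_form_nondegenerate`), plus its `K`-linear
packaging `Polarization.adjointBaseChangeLinear` — and THEOREMS; no named fact (net debt `0`).

## The source, verbatim

J. S. Milne, *Lefschetz classes on abelian varieties*, Duke Math. J. **96** (1999) 639–675 [Milne1999LefschetzClasses]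
(held `paper:doi-10-1215-s0012-7094-99-09620-5`; Duke page = folio + 638). §1 p. 642 (p0004) L64–L74: "When `D` is ample,
`e_D` is nondegenerate, and we let `β†` denote the adjoint with respect to `e_D` of a `k`-linear endomorphism `β` of `V(A)`:
**`e_D(βx, y) = e_D(x, β†y)`, all `x, y ∈ V(A)`.** Then `β ↦ β†` is an involution of the `k`-algebra `End_k(V(A))` whose
restriction to `End⁰(A)` is the Rosati involution defined by `D`. If `D′` is a second divisor on `A`, then
`e_{D′} = e_D ∘ (α × 1)` for some `α ∈ End⁰(A)` with `α† = α` (Mumford 1970, p208), and the involution defined by `D′` (if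
also ample) is `β ↦ α⁻¹β†α`." p. 643 (p0005) L5–L6: "`C(A)` is a `k`-algebra stable under the involution `†` defined by an
ample divisor `D`, and the restriction of `†` to `C(A)` is independent of the choice of `D`." L41–L42 (proof of Prop. 1.3):
"any `k`-bilinear form `ψ` […] can be written `ψ = e_{D₀} ∘ (β × 1)` for some `β ∈ End_k(V(A))`. **If `ψ` is skew-symmetric,
then `β = β†`**". p. 644 (p0006) L16–L20: "**`S(A)(R) = {γ ∈ C(A) ⊗_k R | γ†γ = 1}`.**" Remark 1.6 (L30–L38): for
`k′ ⊇ k`, `C′(A) ≅ C(A) ⊗_k k′`, `S′(A) ≅ S(A)_{/k′}`. §4 p. 659 (p0021) L10–L17: "**`G(A)(R) = {γ ∈ C(A) ⊗ R | γ†γ ∈ R^×}`**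
[…] `e_D(γx, γy) = e_D(x, γ†γx) = γ†γ · e_D(x, y)`, all `x, y ∈ V(A)`".

CARRIER. `H : HodgeStructure V n`, `Q : Polarization H` (any weight: `Q` is `ε = (-1)ⁿ`-symmetric), a field `K ⊇ ℚ` (Milne's
coefficient field `k`, or `k′` of Remark 1.6; Betti: `k = ℚ`), `V(A) ⊗ K = K ⊗_ℚ V`, `e_D = Q_K = Q.form.baseChange K`,
`E_φ = End_HS(H) = H.endAlg`, `C(H) = Subalgebra.centralizer ℚ E_φ`; "`γ ∈ C(A) ⊗ K`" in the two readings of g18-#1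
(commutes with every `a_K`, `a ∈ E_φ` ∕ lies in `span_K {c_K : c ∈ C(H)}`).

## What is PROVED (namespace `Literature.AlgebraicGeometry.Motives.HodgeStructure`)

* §1 `Polarization.baseChange_form_swap` (`Q_K(y, x) = ε Q_K(x, y)`), `isAdjointPair_baseChange_symm` (left = right adjoints),
  `isAdjointPair_baseChange_unique`.
* §2 **DEF `Polarization.adjointBaseChange K Q β = β†`** with **`isAdjointPair_adjointBaseChange`: `Q_K(βx, y) = Q_K(x, β†y)`**
  (and `_left`, `baseChange_form_apply_adjointBaseChange`, `baseChange_form_adjointBaseChange_apply`), uniqueness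
  `eq_adjointBaseChange_of_isAdjointPair`; "an involution of the `k`-algebra": `adjointBaseChange_adjointBaseChange` (`β†† = β`),
  `_injective`, `_mul` (`(βγ)† = γ†β†`), `_one`, `_zero`, `_add`, `_smul`, `_sub`, DEF `adjointBaseChangeLinear`; "whose
  restriction to `End⁰(A)` is the Rosati involution": **`adjointBaseChange_baseChange` (`(a ⊗ 1)† = a† ⊗ 1`)**,
  `adjointBaseChange_mem_span_baseChange_endAlg` (`E_φ ⊗ K` is `†`-stable); "`C(A)` is stable under `†`" on `K`-points:
  `forall_baseChange_comp_adjointBaseChange_of_forall_comm`, `adjointBaseChange_mem_span_baseChange_centralizer_endAlg`;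
  "the involution defined by `D′` is `β ↦ α⁻¹β†α`": `baseChange_mul_adjointBaseChange_eq_of_form_eq` (`α_K β† = β†′ α_K`),
  **`adjointBaseChange_eq_conj_of_form_eq` (`β† = α_K⁻¹ β†′ α_K`)**; "independent of the choice of `D`" on `C ⊗ K`:
  **`adjointBaseChange_eq_adjointBaseChange_of_forall_comm`**.
* §3 **`Polarization.mem_lefschetzGroupBaseChange_iff_adjointBaseChange_mul_self_eq_one` — `S(H)(K) = {γ ∈ C ⊗ K | γ†γ = 1}`
  literally** (and `…_iff_mem_span_and_…` in the span reading; `forall_baseChange_form_apply_apply_iff_adjointBaseChange_mul_self_eq_one`: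
  "preserves `Q_K`" ⟺ "`γ†γ = 1`"), **`Polarization.mem_lefschetzSimilitudeGroupBaseChange_iff_adjointBaseChange_mul_self_eq_smul`
  — `G(H)(K) = {γ ∈ C ⊗ K | γ†γ ∈ K^× · 1}` literally** (`forall_baseChange_form_apply_apply_eq_mul_iff_adjointBaseChange_mul_self_eq_smul`:
  "`e_D(γx, γy) = γ†γ · e_D(x, y)`"), `adjointBaseChange_coe_eq_coe_inv_of_mem_lefschetzGroupBaseChange` (`γ† = γ⁻¹` on `S`).
* §4 `Polarization.adjointBaseChange_mul_self_eq_multiplierChar_smul`: on `MT(H)(K) ≤ G(H)(K)`, `γ†γ = ν(γ) · 1` for the tree's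
  multiplier character (`Motives/MumfordTateMultiplierCharacter`); `…_eq_one_of_mem_hodgeGroupBaseChange`.
* §5 **Prop. 1.3 WITH ITS PARITY CLAUSE over `K`**: `forall_baseChange_form_swap_iff_adjointBaseChange_eq_self` (for
  `B = Q_K(β ·, ·)`: `B` is `ε`-symmetric ⟺ `β† = β` — "If `ψ` is skew-symmetric, then `β = β†`") and
  **`Polarization.forall_centralizer_baseChange_form_apply_adjoint_and_swap_iff`**: `B` is `†`-equivariant under `C(H)` and
  `ε`-symmetric ⟺ `B = Q_K(β ·, ·)` with `β ∈ E_φ ⊗ K`, `β† = β` (g18-#8 gives (1.2), §2 gives `†`); the `ℚ`-version is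
  g18-#2's `forall_centralizer_form_apply_adjoint_and_swap_iff`.

TWINS ON OTHER CARRIERS, BY NAME ONLY (not imported): `Milne1999/LefschetzCentraliserRosatiInvolution`,
`Milne1999/LefschetzCentraliser` (complex abelian varieties on `H¹(A(ℂ); ℂ)`, `ℂ`-points); `HodgeTheory/EndAlgebraRosatiNormalSemisimple`.

NOT HERE: the transport of `†_K` along `e : e^* H ⥲ H` (the `ℚ`-level involution transport is the seat's g20-#4
`Motives/HodgeStructureLefschetzGroupTransport`); `R`-points for a non-field `k`-algebra `R` (the tree works with fields `K`).

## References

* [Milne1999LefschetzClasses] J. S. Milne, *Lefschetz classes on abelian varieties*, Duke Math. J. 96 (1999) 639–675: §1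
  p. 642 L62–L74 (`e_D`, `†`), p. 643 L5–L6, Prop. 1.3 and proof (L34–L51), p. 644 L16–L20 (`S(A)`), Remark 1.6; §4 p. 659
  L10–L17 (`G(A)`, Thm. 4.4).
* [Huybrechts2016K3] D. Huybrechts, *Lectures on K3 surfaces* (2016), §3.3.5 eq. (3.3), Lemma 3.3.12 (the adjoint; `End_Hdg`
  is `†`-stable).
* [MumfordAV1970] D. Mumford, *Abelian varieties* (1970), §20–§21, Application III p. 208.
-/

noncomputable section

open scoped TensorProduct

universe uK u

namespace Literature.AlgebraicGeometry.Motives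

namespace HodgeStructure

/-! ### §1 `Q_K` is `(-1)ⁿ`-symmetric; adjoint pairs for `Q_K` are symmetric and unique -/

section Symmetry

variable (K : Type uK) [Field K] [Algebra ℚ K] {V : Type u} [AddCommGroup V] [Module ℚ V] {n : ℤ}
  {H : HodgeStructure V n} (Q : Polarization H)

omit [Algebra ℚ K] in
/-- `(-1)ⁿ · (-1)ⁿ = 1` in `K` (the tree's `negOnePow_cast_mul_self` is the case `K = ℂ`). Private plumbing. [folklore] -/
private theorem negOnePow_cast_mul_self_field :
    (((n.negOnePow : ℤˣ) : ℤ) : K) * (((n.negOnePow : ℤˣ) : ℤ) : K) = 1 := by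
  rw [← Int.cast_mul, ← Units.val_mul, Int.units_mul_self, Units.val_one, Int.cast_one]

/-- **`Q_K` is `(-1)ⁿ`-symmetric**: `Q_K(y, x) = (-1)ⁿ Q_K(x, y)` ("a skew-symmetric pairing `e_D`" for odd weight, after
extension of scalars, Remark 1.6). [cite: Milne1999LefschetzClasses, §1 p. 642 L62–L63 and Remark 1.6 (p. 644)] -/
theorem Polarization.baseChange_form_swap (x y : K ⊗[ℚ] V) :
    Q.form.baseChange K y x = (((n.negOnePow : ℤˣ) : ℤ) : K) * Q.form.baseChange K x y := by
  induction x using TensorProduct.induction_on with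
  | zero => simp only [map_zero, LinearMap.zero_apply, mul_zero]
  | add x x' hx hx' => rw [map_add, map_add, LinearMap.add_apply, hx, hx', mul_add]
  | tmul c v =>
    induction y using TensorProduct.induction_on with
    | zero => simp only [map_zero, LinearMap.zero_apply, mul_zero]
    | add y y' hy hy' => rw [map_add, map_add, LinearMap.add_apply, hy, hy', mul_add]
    | tmul d w =>
      rw [LinearMap.BilinForm.baseChange_tmul, LinearMap.BilinForm.baseChange_tmul, Q.form_swap v w, mul_comm d c, mul_smul,
        Algebra.smul_def (((n.negOnePow : ℤˣ) : ℤ) : ℚ), map_intCast]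

/-- Adjoint pairs for `Q_K` are symmetric: `Q_K(f x, y) = Q_K(x, g y)` for all `x, y` implies `Q_K(g x, y) = Q_K(x, f y)` (left
and right adjoints coincide for a `(-1)ⁿ`-symmetric form). [cite: Milne1999LefschetzClasses, §1 p. 642 L64–L70] -/
theorem Polarization.isAdjointPair_baseChange_symm {f g : Module.End K (K ⊗[ℚ] V)}
    (h : LinearMap.IsAdjointPair (Q.form.baseChange K) (Q.form.baseChange K) f g) :
    LinearMap.IsAdjointPair (Q.form.baseChange K) (Q.form.baseChange K) g f := by
  intro x y
  calc Q.form.baseChange K (g x) y = (((n.negOnePow : ℤˣ) : ℤ) : K) * Q.form.baseChange K y (g x) :=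
        Q.baseChange_form_swap K y (g x)
    _ = (((n.negOnePow : ℤˣ) : ℤ) : K) * Q.form.baseChange K (f y) x := by rw [h y x]
    _ = (((n.negOnePow : ℤˣ) : ℤ) : K) * ((((n.negOnePow : ℤˣ) : ℤ) : K) * Q.form.baseChange K x (f y)) := by
        rw [Q.baseChange_form_swap K x (f y)]
    _ = Q.form.baseChange K x (f y) := by rw [← mul_assoc, negOnePow_cast_mul_self_field K, one_mul]

variable [Module.Finite ℚ V]

/-- Adjoints for `Q_K` are unique ("`e_D` is nondegenerate", over `K`: g18-#8's `Polarization.baseChange_form_nondegenerate`).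
[cite: Milne1999LefschetzClasses, §1 p. 642 L64–L68] -/
theorem Polarization.isAdjointPair_baseChange_unique {f g g' : Module.End K (K ⊗[ℚ] V)}
    (h : LinearMap.IsAdjointPair (Q.form.baseChange K) (Q.form.baseChange K) f g)
    (h' : LinearMap.IsAdjointPair (Q.form.baseChange K) (Q.form.baseChange K) f g') : g = g' := by
  refine LinearMap.ext fun y ↦ ?_
  rw [← sub_eq_zero, ← LinearMap.sub_apply]
  refine (Q.baseChange_form_nondegenerate K).2 _ fun x ↦ ?_
  rw [LinearMap.sub_apply, map_sub, ← h x y, ← h' x y, sub_self]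

end Symmetry

/-! ### §2 Milne's involution `β ↦ β†` of the `K`-algebra `End_K(K ⊗ V)`: "`e_D(βx, y) = e_D(x, β†y)`" -/

section Adjoint

variable (K : Type uK) [Field K] [Algebra ℚ K] {V : Type u} [AddCommGroup V] [Module ℚ V] [Module.Finite ℚ V] {n : ℤ}
  {H : HodgeStructure V n} (Q : Polarization H)

/-- **Milne's adjoint `β†` of a `K`-linear endomorphism `β` of `V(A) ⊗ K = K ⊗_ℚ V` with respect to `e_D = Q_K`**:
"When `D` is ample, `e_D` is nondegenerate, and we let `β†` denote the adjoint with respect to `e_D` of a `k`-linear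
endomorphism `β` of `V(A)`: `e_D(βx, y) = e_D(x, β†y)`, all `x, y ∈ V(A)`" — here for the coefficient field `K ⊇ ℚ`
(Remark 1.6: the theory with coefficients `k′ ⊇ k` is the base change), Mathlib's left adjoint for the non-degenerate form
`Q_K` (which is also the right adjoint, `isAdjointPair_adjointBaseChange`). For `K = ℚ` and `β = a ⊗ 1` it is the tree's
`Polarization.adjoint` (`adjointBaseChange_baseChange`). [cite: Milne1999LefschetzClasses, §1 p. 642 L64–L68] -/
def Polarization.adjointBaseChange (β : Module.End K (K ⊗[ℚ] V)) : Module.End K (K ⊗[ℚ] V) :=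
  (Q.form.baseChange K).leftAdjointOfNondegenerate (Q.baseChange_form_nondegenerate K) β

/-- `Q_K(β† x, y) = Q_K(x, β y)`. [cite: Milne1999LefschetzClasses, §1 p. 642 L64–L68] -/
theorem Polarization.isAdjointPair_adjointBaseChange_left (β : Module.End K (K ⊗[ℚ] V)) :
    LinearMap.IsAdjointPair (Q.form.baseChange K) (Q.form.baseChange K) (Q.adjointBaseChange K β) β :=
  (Q.form.baseChange K).isAdjointPairLeftAdjointOfNondegenerate (Q.baseChange_form_nondegenerate K) β

/-- **"`e_D(βx, y) = e_D(x, β†y)`, all `x, y`"**. [cite: Milne1999LefschetzClasses, §1 p. 642 L66–L68] -/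
theorem Polarization.isAdjointPair_adjointBaseChange (β : Module.End K (K ⊗[ℚ] V)) :
    LinearMap.IsAdjointPair (Q.form.baseChange K) (Q.form.baseChange K) β (Q.adjointBaseChange K β) :=
  Q.isAdjointPair_baseChange_symm K (Q.isAdjointPair_adjointBaseChange_left K β)

/-- `Q_K(x, β† y) = Q_K(β x, y)`, elementwise. [cite: Milne1999LefschetzClasses, §1 p. 642 L66–L68] -/
theorem Polarization.baseChange_form_apply_adjointBaseChange (β : Module.End K (K ⊗[ℚ] V)) (x y : K ⊗[ℚ] V) :
    Q.form.baseChange K x (Q.adjointBaseChange K β y) = Q.form.baseChange K (β x) y :=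
  (Q.isAdjointPair_adjointBaseChange K β x y).symm

/-- `Q_K(β† x, y) = Q_K(x, β y)`, elementwise. [cite: Milne1999LefschetzClasses, §1 p. 642 L66–L68] -/
theorem Polarization.baseChange_form_adjointBaseChange_apply (β : Module.End K (K ⊗[ℚ] V)) (x y : K ⊗[ℚ] V) :
    Q.form.baseChange K (Q.adjointBaseChange K β x) y = Q.form.baseChange K x (β y) :=
  Q.isAdjointPair_adjointBaseChange_left K β x y

/-- **Uniqueness**: any `Q_K`-adjoint of `β` is `β†`. [cite: Milne1999LefschetzClasses, §1 p. 642 L64–L68] -/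
theorem Polarization.eq_adjointBaseChange_of_isAdjointPair {β γ : Module.End K (K ⊗[ℚ] V)}
    (h : LinearMap.IsAdjointPair (Q.form.baseChange K) (Q.form.baseChange K) β γ) : γ = Q.adjointBaseChange K β :=
  Q.isAdjointPair_baseChange_unique K h (Q.isAdjointPair_adjointBaseChange K β)

/-- **"`β ↦ β†` is an involution"**: `β†† = β`. [cite: Milne1999LefschetzClasses, §1 p. 642 L70] -/
@[simp]
theorem Polarization.adjointBaseChange_adjointBaseChange (β : Module.End K (K ⊗[ℚ] V)) :
    Q.adjointBaseChange K (Q.adjointBaseChange K β) = β :=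
  (Q.eq_adjointBaseChange_of_isAdjointPair K (Q.isAdjointPair_adjointBaseChange_left K β)).symm

/-- `†` is injective. [cite: Milne1999LefschetzClasses, §1 p. 642 L70] -/
theorem Polarization.adjointBaseChange_injective : Function.Injective (Q.adjointBaseChange K) :=
  Function.LeftInverse.injective (Q.adjointBaseChange_adjointBaseChange K)

/-- **"of the `k`-algebra `End_k(V(A))`"** — `†` is an anti-homomorphism: `(β γ)† = γ† β†`. [cite: Milne1999LefschetzClasses, §1 p. 642 L70] -/
theorem Polarization.adjointBaseChange_mul (β γ : Module.End K (K ⊗[ℚ] V)) :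
    Q.adjointBaseChange K (β * γ) = Q.adjointBaseChange K γ * Q.adjointBaseChange K β :=
  (Q.eq_adjointBaseChange_of_isAdjointPair K
    ((Q.isAdjointPair_adjointBaseChange K β).mul (Q.isAdjointPair_adjointBaseChange K γ))).symm

/-- `1† = 1`. [cite: Milne1999LefschetzClasses, §1 p. 642 L70] -/
@[simp]
theorem Polarization.adjointBaseChange_one : Q.adjointBaseChange K 1 = 1 :=
  (Q.eq_adjointBaseChange_of_isAdjointPair K LinearMap.isAdjointPair_one).symm

/-- `0† = 0`. [cite: Milne1999LefschetzClasses, §1 p. 642 L70] -/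
@[simp]
theorem Polarization.adjointBaseChange_zero : Q.adjointBaseChange K 0 = 0 :=
  (Q.eq_adjointBaseChange_of_isAdjointPair K fun x y ↦ by simp).symm

/-- `(β + γ)† = β† + γ†`. [cite: Milne1999LefschetzClasses, §1 p. 642 L70] -/
theorem Polarization.adjointBaseChange_add (β γ : Module.End K (K ⊗[ℚ] V)) :
    Q.adjointBaseChange K (β + γ) = Q.adjointBaseChange K β + Q.adjointBaseChange K γ := by
  refine (Q.eq_adjointBaseChange_of_isAdjointPair K fun x y ↦ ?_).symm
  rw [LinearMap.add_apply, LinearMap.add_apply, map_add, LinearMap.add_apply, map_add,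
    Q.baseChange_form_apply_adjointBaseChange K, Q.baseChange_form_apply_adjointBaseChange K]

/-- `(c β)† = c β†` for `c ∈ K` (`†` is `K`-linear). [cite: Milne1999LefschetzClasses, §1 p. 642 L70] -/
theorem Polarization.adjointBaseChange_smul (c : K) (β : Module.End K (K ⊗[ℚ] V)) :
    Q.adjointBaseChange K (c • β) = c • Q.adjointBaseChange K β := by
  refine (Q.eq_adjointBaseChange_of_isAdjointPair K fun x y ↦ ?_).symm
  rw [LinearMap.smul_apply, LinearMap.smul_apply, map_smul, LinearMap.smul_apply, map_smul,
    Q.baseChange_form_apply_adjointBaseChange K]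

/-- `(β - γ)† = β† - γ†`. [cite: Milne1999LefschetzClasses, §1 p. 642 L70] -/
theorem Polarization.adjointBaseChange_sub (β γ : Module.End K (K ⊗[ℚ] V)) :
    Q.adjointBaseChange K (β - γ) = Q.adjointBaseChange K β - Q.adjointBaseChange K γ := by
  refine (Q.eq_adjointBaseChange_of_isAdjointPair K fun x y ↦ ?_).symm
  rw [LinearMap.sub_apply, LinearMap.sub_apply, map_sub, LinearMap.sub_apply, map_sub,
    Q.baseChange_form_apply_adjointBaseChange K, Q.baseChange_form_apply_adjointBaseChange K]

/-- **The involution `†` as a `K`-linear self-map of `End_K(K ⊗ V)`** (the additive and `K`-homogeneous structure of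
"an involution of the `k`-algebra `End_k(V(A))`"; multiplicativity is reversed, `adjointBaseChange_mul`).
[cite: Milne1999LefschetzClasses, §1 p. 642 L70] -/
def Polarization.adjointBaseChangeLinear : Module.End K (K ⊗[ℚ] V) →ₗ[K] Module.End K (K ⊗[ℚ] V) where
  toFun := Q.adjointBaseChange K
  map_add' := Q.adjointBaseChange_add K
  map_smul' := Q.adjointBaseChange_smul K

/-- `adjointBaseChangeLinear` is `†`. [cite: Milne1999LefschetzClasses, §1 p. 642 L70] -/
@[simp]
theorem Polarization.adjointBaseChangeLinear_apply (β : Module.End K (K ⊗[ℚ] V)) :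
    Q.adjointBaseChangeLinear K β = Q.adjointBaseChange K β :=
  rfl

/-! #### "whose restriction to `End⁰(A)` is the Rosati involution": `†` commutes with extension of scalars -/

/-- **`(a ⊗ 1)† = a† ⊗ 1`**: on base-changed endomorphisms `a_K`, `a ∈ End_ℚ(V)`, Milne's `K`-linear adjoint is the base
change of the rational adjoint `a† = Polarization.adjoint` ("whose restriction to `End⁰(A)` is the Rosati involution defined
by `D`", read with coefficients extended to `K`, Remark 1.6). [cite: Milne1999LefschetzClasses, §1 p. 642 L70–L71 and Remark 1.6 (p. 644)] -/
theorem Polarization.adjointBaseChange_baseChange (a : Module.End ℚ V) :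
    Q.adjointBaseChange K (a.baseChange K) = (Q.adjoint a).baseChange K :=
  (Q.eq_adjointBaseChange_of_isAdjointPair K fun x y ↦ Q.baseChange_form_baseChange_apply_eq_adjoint K a x y).symm

/-- `E_φ ⊗ K` (the `K`-span of the `a_K`, `a ∈ End_HS(H)`) is `†`-stable (Huybrechts Lemma 3.3.12 on `K`-points: `E_φ` is
stable under the Rosati involution, the tree's `Polarization.adjoint_mem_endAlg`). [cite: Milne1999LefschetzClasses, §1 p. 642 L70–L71]
[cite: Huybrechts2016K3, Lemma 3.3.12] -/
theorem Polarization.adjointBaseChange_mem_span_baseChange_endAlg {β : Module.End K (K ⊗[ℚ] V)}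
    (hβ : β ∈ Submodule.span K (Set.range fun a : H.endAlg ↦ (a : Module.End ℚ V).baseChange K)) :
    Q.adjointBaseChange K β ∈ Submodule.span K (Set.range fun a : H.endAlg ↦ (a : Module.End ℚ V).baseChange K) := by
  induction hβ using Submodule.span_induction with
  | mem x hx =>
    obtain ⟨a, rfl⟩ := hx
    rw [Q.adjointBaseChange_baseChange K]
    exact Submodule.subset_span ⟨⟨Q.adjoint a, Q.adjoint_mem_endAlg a.2⟩, rfl⟩
  | zero => rw [Q.adjointBaseChange_zero K]; exact Submodule.zero_mem _
  | add x y _ _ hx hy => rw [Q.adjointBaseChange_add K]; exact Submodule.add_mem _ hx hy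
  | smul c x _ hx => rw [Q.adjointBaseChange_smul K]; exact Submodule.smul_mem _ c hx

/-- **"`C(A)` is a `k`-algebra stable under the involution `†`"**, on `K`-points, in the commutation reading of `C(A) ⊗ K`:
if `β ∈ End_K(K ⊗ V)` commutes with every `a_K`, `a ∈ End_HS(H)`, then so does `β†` — for `a ∈ E_φ`,
`a_K β† = ((β (a†)_K)†…)`: `(a_K β†) = (β (a_K)†)† = (β (a†)_K)† = ((a†)_K β)† = β† a_K` since `a† ∈ E_φ`.
[cite: Milne1999LefschetzClasses, §1 p. 643 L5–L6] -/
theorem Polarization.forall_baseChange_comp_adjointBaseChange_of_forall_comm {β : Module.End K (K ⊗[ℚ] V)}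
    (hβ : ∀ a : H.endAlg, (a : Module.End ℚ V).baseChange K * β = β * (a : Module.End ℚ V).baseChange K) :
    ∀ a : H.endAlg, (a : Module.End ℚ V).baseChange K * Q.adjointBaseChange K β =
      Q.adjointBaseChange K β * (a : Module.End ℚ V).baseChange K := by
  intro a
  have ha : Q.adjoint (a : Module.End ℚ V) ∈ H.endAlg := Q.adjoint_mem_endAlg a.2
  have h := congrArg (Q.adjointBaseChange K) (hβ ⟨_, ha⟩)
  rw [Q.adjointBaseChange_mul K, Q.adjointBaseChange_mul K, Q.adjointBaseChange_baseChange K, Polarization.adjoint_adjoint] at h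
  exact h.symm

/-- The same in the span reading `C(H) ⊗ K = span_K {c_K : c ∈ C(H)}`: `C(H) ⊗ K` is `†`-stable (g18-#1's
`Polarization.adjoint_mem_centralizer_endAlg` on each generator). [cite: Milne1999LefschetzClasses, §1 p. 643 L5–L6] -/
theorem Polarization.adjointBaseChange_mem_span_baseChange_centralizer_endAlg {β : Module.End K (K ⊗[ℚ] V)}
    (hβ : β ∈ Submodule.span K ((fun c : Module.End ℚ V ↦ c.baseChange K) ''
      (Subalgebra.centralizer ℚ (H.endAlg : Set (Module.End ℚ V)) : Set (Module.End ℚ V)))) :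
    Q.adjointBaseChange K β ∈ Submodule.span K ((fun c : Module.End ℚ V ↦ c.baseChange K) ''
      (Subalgebra.centralizer ℚ (H.endAlg : Set (Module.End ℚ V)) : Set (Module.End ℚ V))) := by
  induction hβ using Submodule.span_induction with
  | mem x hx =>
    obtain ⟨c, hc, rfl⟩ := hx
    rw [Q.adjointBaseChange_baseChange K]
    exact Submodule.subset_span ⟨Q.adjoint c, Q.adjoint_mem_centralizer_endAlg hc, rfl⟩
  | zero => rw [Q.adjointBaseChange_zero K]; exact Submodule.zero_mem _
  | add x y _ _ hx hy => rw [Q.adjointBaseChange_add K]; exact Submodule.add_mem _ hx hy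
  | smul c x _ hx => rw [Q.adjointBaseChange_smul K]; exact Submodule.smul_mem _ c hx

/-! #### "If `D′` is a second divisor … the involution defined by `D′` is `β ↦ α⁻¹β†α`", on `K`-points -/

/-- For two polarizations with `Q(v, w) = Q′(α v, w)` (`α ∈ E_φ^×`, `α^{†′} = α`, g18-#1), on `K`-points:
`α_K · β^† = β^{†′} · α_K` for every `K`-linear `β`, where `†` is the `Q_K`-adjoint and `†′` the `Q′_K`-adjoint.
[cite: Milne1999LefschetzClasses, §1 p. 642 L71–L74] -/
theorem Polarization.baseChange_mul_adjointBaseChange_eq_of_form_eq (Q' : Polarization H) {α : Module.End ℚ V}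
    (hα : ∀ v w, Q.form v w = Q'.form (α v) w) (β : Module.End K (K ⊗[ℚ] V)) :
    α.baseChange K * Q.adjointBaseChange K β = Q'.adjointBaseChange K β * α.baseChange K := by
  have hαK : ∀ x y, Q.form.baseChange K x y = Q'.form.baseChange K (α.baseChange K x) y := fun x y ↦ by
    induction x using TensorProduct.induction_on with
    | zero => simp only [map_zero, LinearMap.zero_apply]
    | add x x' hx hx' => simp only [map_add, LinearMap.add_apply, hx, hx']
    | tmul c v =>
      induction y using TensorProduct.induction_on with
      | zero => simp only [map_zero]
      | add y y' hy hy' => simp only [map_add, hy, hy']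
      | tmul d w => rw [LinearMap.baseChange_tmul, LinearMap.BilinForm.baseChange_tmul, LinearMap.BilinForm.baseChange_tmul, hα]
  have hαadj : Q'.adjointBaseChange K (α.baseChange K) = α.baseChange K := by
    rw [Q'.adjointBaseChange_baseChange K, Q.adjoint_eq_self_of_form_eq' Q' hα]
  have hpair : LinearMap.IsAdjointPair (Q'.form.baseChange K) (Q'.form.baseChange K) (α.baseChange K * β)
      (α.baseChange K * Q.adjointBaseChange K β) := by
    intro x y
    rw [Module.End.mul_apply, Module.End.mul_apply, ← hαK, ← Q.baseChange_form_apply_adjointBaseChange K β x, hαK,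
      ← Q'.baseChange_form_adjointBaseChange_apply K (α.baseChange K), hαadj]
  rw [Q'.eq_adjointBaseChange_of_isAdjointPair K hpair, Q'.adjointBaseChange_mul K, hαadj]

/-- The printed form on `K`-points: **`β^† = α_K⁻¹ β^{†′} α_K`**. [cite: Milne1999LefschetzClasses, §1 p. 642 L71–L74] -/
theorem Polarization.adjointBaseChange_eq_conj_of_form_eq (Q' : Polarization H) {α : Module.End ℚ V}
    (hα : ∀ v w, Q.form v w = Q'.form (α v) w) (β : Module.End K (K ⊗[ℚ] V)) :
    Q.adjointBaseChange K β =
      ↑((Q.isUnit_of_form_eq Q' hα).map (Module.End.baseChangeHom ℚ K V)).unit⁻¹ * Q'.adjointBaseChange K β *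
        α.baseChange K := by
  have hu : (↑((Q.isUnit_of_form_eq Q' hα).map (Module.End.baseChangeHom ℚ K V)).unit⁻¹ : Module.End K (K ⊗[ℚ] V)) *
      α.baseChange K = 1 :=
    IsUnit.val_inv_mul _
  rw [mul_assoc, ← Q.baseChange_mul_adjointBaseChange_eq_of_form_eq K Q' hα β, ← mul_assoc, hu, one_mul]

/-- The restriction of `†` to `C(H) ⊗ K` does not depend on the polarization (on elements commuting with `E_φ ⊗ K`, in
particular with `α_K`): `β^† = β^{†′}` — "the restriction of `†` to `C(A)` is independent of the choice of `D`", on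
`K`-points. [cite: Milne1999LefschetzClasses, §1 p. 643 L5–L6] -/
theorem Polarization.adjointBaseChange_eq_adjointBaseChange_of_forall_comm (Q' : Polarization H)
    [HodgeTensorFacts.{u, u}] {β : Module.End K (K ⊗[ℚ] V)}
    (hβ : ∀ a : H.endAlg, (a : Module.End ℚ V).baseChange K * β = β * (a : Module.End ℚ V).baseChange K) :
    Q.adjointBaseChange K β = Q'.adjointBaseChange K β := by
  obtain ⟨α, hα⟩ : ∃ α : Module.End ℚ V, ∀ v w, Q.form v w = Q'.form (α v) w :=
    ⟨(Q'.toDualEquiv.symm : Module.Dual ℚ V →ₗ[ℚ] V) ∘ₗ (Q.toDualEquiv : V →ₗ[ℚ] Module.Dual ℚ V),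
      fun v w ↦ Q.form_eq_form_toDualEquiv_symm_toDualEquiv Q' v w⟩
  have hαE : α ∈ H.endAlg := Q.mem_endAlg_of_form_eq Q' hα
  have hcomm := Q.forall_baseChange_comp_adjointBaseChange_of_forall_comm K hβ ⟨α, hαE⟩
  have h := Q.baseChange_mul_adjointBaseChange_eq_of_form_eq K Q' hα β
  rw [hcomm] at h
  have hunit : IsUnit (α.baseChange K) := (Q.isUnit_of_form_eq Q' hα).map (Module.End.baseChangeHom ℚ K V)
  exact hunit.mul_right_cancel h

end Adjoint

/-! ### §3 "`S(A)(R) = {γ ∈ C(A) ⊗ R | γ†γ = 1}`", "`G(A)(R) = {γ ∈ C(A) ⊗ R | γ†γ ∈ R^×}`" on `K`-points, literally -/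

section Groups

variable (K : Type uK) [Field K] [Algebra ℚ K] {V : Type u} [AddCommGroup V] [Module ℚ V] [Module.Finite ℚ V] {n : ℤ}
  {H : HodgeStructure V n} (Q : Polarization H)

/-- **"`γ†γ = 1`" is "γ preserves `e_D`"**, on `K`-points: for `γ ∈ GL(K ⊗ V)`, `Q_K(γ x, γ y) = Q_K(x, y)` for all `x, y`
iff `γ† γ = 1` (`Q_K(γ x, γ y) = Q_K(x, γ†γ y)`, `Q_K` non-degenerate). [cite: Milne1999LefschetzClasses, §1 p. 644 L18–L20] -/
theorem Polarization.forall_baseChange_form_apply_apply_iff_adjointBaseChange_mul_self_eq_one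
    (γ : (K ⊗[ℚ] V) ≃ₗ[K] (K ⊗[ℚ] V)) :
    (∀ x y, Q.form.baseChange K (γ x) (γ y) = Q.form.baseChange K x y) ↔
      Q.adjointBaseChange K (γ : Module.End K (K ⊗[ℚ] V)) * (γ : Module.End K (K ⊗[ℚ] V)) = 1 := by
  constructor
  · intro h
    have hpair : LinearMap.IsAdjointPair (Q.form.baseChange K) (Q.form.baseChange K) (γ : Module.End K (K ⊗[ℚ] V))
        ((γ⁻¹ : (K ⊗[ℚ] V) ≃ₗ[K] (K ⊗[ℚ] V)) : Module.End K (K ⊗[ℚ] V)) := by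
      intro x y
      rw [LinearEquiv.coe_coe, LinearEquiv.coe_coe]
      conv_lhs => rw [← γ.apply_symm_apply y]
      exact h x (γ⁻¹ y)
    rw [← Q.eq_adjointBaseChange_of_isAdjointPair K hpair, ← LinearEquiv.coe_toLinearMap_mul, inv_mul_cancel]
    rfl
  · intro h x y
    rw [← LinearEquiv.coe_coe γ, ← Q.baseChange_form_apply_adjointBaseChange K, ← Module.End.mul_apply, h,
      Module.End.one_apply]

/-- **Milne's `S(A)(R) = {γ ∈ C(A) ⊗_k R | γ†γ = 1}`, LITERALLY, for `R = K` a field ⊇ `ℚ`**: `γ ∈ S(H)(K)` iff `γ` commutes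
with every `a_K`, `a ∈ E_φ` (i.e. `γ ∈ C(H) ⊗ K`, g18-#1's `coe_mem_span_baseChange_centralizer_endAlg_of_mem_lefschetzGroupBaseChange`)
and `γ† γ = 1` for Milne's `K`-linear involution `†` of §2 (g18-#1 defines `S(H)(K)` through "`γ` preserves `Q_K`"; for
`K = ℚ` this is its `mem_lefschetzGroup_iff_adjoint_mul_self_eq_one`). [cite: Milne1999LefschetzClasses, §1 p. 644 L16–L20] -/
theorem Polarization.mem_lefschetzGroupBaseChange_iff_adjointBaseChange_mul_self_eq_one
    (γ : (K ⊗[ℚ] V) ≃ₗ[K] (K ⊗[ℚ] V)) :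
    γ ∈ Q.lefschetzGroupBaseChange K ↔
      (∀ a : H.endAlg, ∀ x, (a : Module.End ℚ V).baseChange K (γ x) = γ ((a : Module.End ℚ V).baseChange K x)) ∧
        Q.adjointBaseChange K (γ : Module.End K (K ⊗[ℚ] V)) * (γ : Module.End K (K ⊗[ℚ] V)) = 1 := by
  rw [Polarization.mem_lefschetzGroupBaseChange_iff,
    Q.forall_baseChange_form_apply_apply_iff_adjointBaseChange_mul_self_eq_one K γ]

/-- The same with "`γ ∈ C(A) ⊗ K`" in the span reading: `γ ∈ S(H)(K)` iff `↑γ ∈ span_K {c_K : c ∈ C(H)}` and `γ†γ = 1`.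
[cite: Milne1999LefschetzClasses, §1 p. 644 L16–L20 and Remark 1.6] -/
theorem Polarization.mem_lefschetzGroupBaseChange_iff_mem_span_and_adjointBaseChange_mul_self_eq_one
    (γ : (K ⊗[ℚ] V) ≃ₗ[K] (K ⊗[ℚ] V)) :
    γ ∈ Q.lefschetzGroupBaseChange K ↔
      (γ : Module.End K (K ⊗[ℚ] V)) ∈ Submodule.span K ((fun c : Module.End ℚ V ↦ c.baseChange K) ''
          (Subalgebra.centralizer ℚ (H.endAlg : Set (Module.End ℚ V)) : Set (Module.End ℚ V))) ∧
        Q.adjointBaseChange K (γ : Module.End K (K ⊗[ℚ] V)) * (γ : Module.End K (K ⊗[ℚ] V)) = 1 := by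
  rw [Q.mem_lefschetzGroupBaseChange_iff_mem_span_and γ,
    Q.forall_baseChange_form_apply_apply_iff_adjointBaseChange_mul_self_eq_one K γ]

/-- **"`e_D(γx, γy) = e_D(x, γ†γx) = γ†γ · e_D(x, y)`"** (proof of Thm. 4.4), on `K`-points: for `γ ∈ GL(K ⊗ V)` and `ν ∈ K`,
`Q_K(γ x, γ y) = ν Q_K(x, y)` for all `x, y` iff `γ† γ = ν · 1`. [cite: Milne1999LefschetzClasses, §4 proof of Thm. 4.4 (p. 659 L16–L17)] -/
theorem Polarization.forall_baseChange_form_apply_apply_eq_mul_iff_adjointBaseChange_mul_self_eq_smul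
    (γ : (K ⊗[ℚ] V) ≃ₗ[K] (K ⊗[ℚ] V)) (ν : K) :
    (∀ x y, Q.form.baseChange K (γ x) (γ y) = ν * Q.form.baseChange K x y) ↔
      Q.adjointBaseChange K (γ : Module.End K (K ⊗[ℚ] V)) * (γ : Module.End K (K ⊗[ℚ] V)) =
        ν • (1 : Module.End K (K ⊗[ℚ] V)) := by
  constructor
  · intro h
    refine LinearMap.ext fun y ↦ ?_
    rw [← sub_eq_zero, ← LinearMap.sub_apply]
    refine (Q.baseChange_form_nondegenerate K).2 _ fun x ↦ ?_
    rw [LinearMap.sub_apply, map_sub, Module.End.mul_apply, Q.baseChange_form_apply_adjointBaseChange K,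
      LinearMap.smul_apply, Module.End.one_apply, map_smul, smul_eq_mul, LinearEquiv.coe_coe, h x y, sub_self]
  · intro h x y
    rw [← LinearEquiv.coe_coe γ, ← Q.baseChange_form_apply_adjointBaseChange K, ← Module.End.mul_apply, h,
      LinearMap.smul_apply, Module.End.one_apply, map_smul, smul_eq_mul]

/-- **Milne's `G(A)(R) = {γ ∈ C(A) ⊗ R | γ†γ ∈ R^×}`, LITERALLY, for `R = K` a field ⊇ `ℚ`**: `γ ∈ G(H)(K)` iff `γ`
commutes with every `a_K`, `a ∈ E_φ`, and `γ† γ = ν · 1` for some `ν ∈ K^×` (g18-#1 defines `G(H)(K)` through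
"`Q_K(γ x, γ y) = ν Q_K(x, y)`"). [cite: Milne1999LefschetzClasses, §4 p. 659 L10–L13] -/
theorem Polarization.mem_lefschetzSimilitudeGroupBaseChange_iff_adjointBaseChange_mul_self_eq_smul
    (γ : (K ⊗[ℚ] V) ≃ₗ[K] (K ⊗[ℚ] V)) :
    γ ∈ Q.lefschetzSimilitudeGroupBaseChange K ↔
      (∀ a : H.endAlg, ∀ x, (a : Module.End ℚ V).baseChange K (γ x) = γ ((a : Module.End ℚ V).baseChange K x)) ∧
        ∃ ν : K, ν ≠ 0 ∧ Q.adjointBaseChange K (γ : Module.End K (K ⊗[ℚ] V)) * (γ : Module.End K (K ⊗[ℚ] V)) =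
          ν • (1 : Module.End K (K ⊗[ℚ] V)) := by
  rw [Polarization.mem_lefschetzSimilitudeGroupBaseChange_iff]
  refine and_congr Iff.rfl (exists_congr fun ν ↦ and_congr Iff.rfl ?_)
  exact Q.forall_baseChange_form_apply_apply_eq_mul_iff_adjointBaseChange_mul_self_eq_smul K γ ν

/-- For `γ ∈ S(H)(K)`: `γ† = γ⁻¹`. [cite: Milne1999LefschetzClasses, §1 p. 644 L18] -/
theorem Polarization.adjointBaseChange_coe_eq_coe_inv_of_mem_lefschetzGroupBaseChange
    {γ : (K ⊗[ℚ] V) ≃ₗ[K] (K ⊗[ℚ] V)} (hγ : γ ∈ Q.lefschetzGroupBaseChange K) :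
    Q.adjointBaseChange K (γ : Module.End K (K ⊗[ℚ] V)) = ((γ⁻¹ : (K ⊗[ℚ] V) ≃ₗ[K] (K ⊗[ℚ] V)) : Module.End K (K ⊗[ℚ] V)) := by
  have h := ((Q.mem_lefschetzGroupBaseChange_iff_adjointBaseChange_mul_self_eq_one K γ).1 hγ).2
  have h1 : Q.adjointBaseChange K (γ : Module.End K (K ⊗[ℚ] V)) * (γ : Module.End K (K ⊗[ℚ] V)) *
      ((γ⁻¹ : (K ⊗[ℚ] V) ≃ₗ[K] (K ⊗[ℚ] V)) : Module.End K (K ⊗[ℚ] V)) =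
        ((γ⁻¹ : (K ⊗[ℚ] V) ≃ₗ[K] (K ⊗[ℚ] V)) : Module.End K (K ⊗[ℚ] V)) := by
    rw [h, one_mul]
  have h2 : (((1 : (K ⊗[ℚ] V) ≃ₗ[K] (K ⊗[ℚ] V)) : Module.End K (K ⊗[ℚ] V))) = 1 := rfl
  rwa [mul_assoc, ← LinearEquiv.coe_toLinearMap_mul, mul_inv_cancel, h2, mul_one] at h1

end Groups

/-! ### §4 "`γ†γ`" is the multiplier character on `MT(H)(K) ≤ G(H)(K)` -/

section Multiplier

variable (K : Type uK) [Field K] [Algebra ℚ K] {V : Type u} [AddCommGroup V] [Module ℚ V] [Module.Finite ℚ V]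
  [HodgeTensorFacts.{u, u}] {n : ℤ} {H : HodgeStructure V n} (Q : Polarization H)

/-- **`γ†γ = ν(γ) · 1` for `γ ∈ MT(H)(K)`**: Milne's "`γ†γ ∈ R^×`" (the second coordinate of `γ ↦ (γ, γ†γ) : G(A) ⥲ L(A)`,
Thm. 4.4) is the tree's multiplier character `Polarization.multiplierChar K Q : MT(H)(K) →* K^×`
(`Motives/MumfordTateMultiplierCharacter`, `Q_K(γ x, γ y) = ν(γ) Q_K(x, y)`). [cite: Milne1999LefschetzClasses, §4 Thm. 4.4 and its proof (p. 659 L14–L17)] -/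
theorem Polarization.adjointBaseChange_mul_self_eq_multiplierChar_smul [Nontrivial V] (γ : H.mumfordTateGroupBaseChange K) :
    Q.adjointBaseChange K ((γ : (K ⊗[ℚ] V) ≃ₗ[K] (K ⊗[ℚ] V)) : Module.End K (K ⊗[ℚ] V)) *
        ((γ : (K ⊗[ℚ] V) ≃ₗ[K] (K ⊗[ℚ] V)) : Module.End K (K ⊗[ℚ] V)) =
      ((Q.multiplierChar K γ : Kˣ) : K) • (1 : Module.End K (K ⊗[ℚ] V)) :=
  (Q.forall_baseChange_form_apply_apply_eq_mul_iff_adjointBaseChange_mul_self_eq_smul K _ _).1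
    (Q.baseChange_form_multiplierChar K γ)

/-- For `γ ∈ Hg(H)(K) ≤ S(H)(K)`: `γ†γ = 1`. [cite: Milne1999LefschetzClasses, §1 p. 644 L18 and §4 p. 660] -/
theorem Polarization.adjointBaseChange_mul_self_eq_one_of_mem_hodgeGroupBaseChange
    {γ : (K ⊗[ℚ] V) ≃ₗ[K] (K ⊗[ℚ] V)} (hγ : γ ∈ H.hodgeGroupBaseChange K) :
    Q.adjointBaseChange K (γ : Module.End K (K ⊗[ℚ] V)) * (γ : Module.End K (K ⊗[ℚ] V)) = 1 :=
  ((Q.mem_lefschetzGroupBaseChange_iff_adjointBaseChange_mul_self_eq_one K γ).1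
    (Q.hodgeGroupBaseChange_le_lefschetzGroupBaseChange K hγ)).2

end Multiplier

/-! ### §5 Proposition 1.3 over `K` with its parity clause: "If `ψ` is skew-symmetric, then `β = β†`" -/

section Parity

variable (K : Type uK) [Field K] [Algebra ℚ K] {V : Type u} [AddCommGroup V] [Module ℚ V] [Module.Finite ℚ V] {n : ℤ}
  {H : HodgeStructure V n} (Q : Polarization H)

/-- **"If `ψ` is skew-symmetric, then `β = β†`"**, as an equivalence, in every weight, on `K`-points: for `B = Q_K(β ·, ·)`
(every `K`-bilinear form on `K ⊗ V` has this shape, g18-#8's `existsUnique_baseChange_form_comp`) and `Q` of parity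
`ε = (-1)ⁿ`, `B` has parity `ε` (`B(y, x) = ε B(x, y)`) iff `β† = β`: `B(y, x) = Q_K(β y, x) = ε Q_K(x, β y) = ε Q_K(β† x, y)`.
[cite: Milne1999LefschetzClasses, §1 Prop. 1.3, proof (p. 643 L41–L42) and Remark 1.6] -/
theorem Polarization.forall_baseChange_form_swap_iff_adjointBaseChange_eq_self {B : LinearMap.BilinForm K (K ⊗[ℚ] V)}
    {β : Module.End K (K ⊗[ℚ] V)} (hβ : ∀ x y, B x y = Q.form.baseChange K (β x) y) :
    (∀ x y, B y x = (((n.negOnePow : ℤˣ) : ℤ) : K) * B x y) ↔ Q.adjointBaseChange K β = β := by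
  have hswap : ∀ x y, B y x = (((n.negOnePow : ℤˣ) : ℤ) : K) * Q.form.baseChange K (Q.adjointBaseChange K β x) y :=
    fun x y ↦ by rw [hβ y x, Q.baseChange_form_swap K x (β y), Q.baseChange_form_adjointBaseChange_apply K β x y]
  constructor
  · intro h
    refine LinearMap.ext fun x ↦ ?_
    rw [← sub_eq_zero]
    refine (Q.baseChange_form_nondegenerate K).1 _ fun y ↦ ?_
    have h1 := h x y
    rw [hswap x y, hβ x y] at h1
    have h2 := mul_left_cancel₀ (by
      intro h0
      have h00 := negOnePow_cast_mul_self_field (n := n) K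
      rw [h0, zero_mul] at h00
      exact zero_ne_one h00) h1
    rw [map_sub, LinearMap.sub_apply, h2, sub_self]
  · intro h x y
    rw [hswap x y, h, hβ x y]

variable [HodgeTensorFacts.{u, u}]

/-- **Proposition 1.3 with its parity clause, over a field `K ⊇ ℚ`** ("The skew-symmetric `k`-bilinear forms `ψ` such that
`ψ ∘ (γ × 1) = ψ ∘ (1 × γ†)`, all `γ ∈ C(A)`, are exactly the `k`-linear combinations of forms `e_D`" — i.e. the
`e_{D₀} ∘ (β × 1)` with `β ∈ End⁰(A) ⊗ k`, `β = β†`): a `K`-bilinear form `B` on `K ⊗ V` is `†`-equivariant under `C(H)` and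
of the parity `ε = (-1)ⁿ` of `Q` iff `B = Q_K(β ·, ·)` for some `β ∈ E_φ ⊗ K` (the `K`-span of the `a_K`) with `β† = β`
(g18-#8's `forall_centralizer_baseChange_form_apply_adjoint_iff_mem_span` supplies (1.2); §2 supplies `†` over `K`).
[cite: Milne1999LefschetzClasses, §1 Prop. 1.3 and its proof (p. 643) and Remark 1.6 (p. 644)] -/
theorem Polarization.forall_centralizer_baseChange_form_apply_adjoint_and_swap_iff (B : LinearMap.BilinForm K (K ⊗[ℚ] V)) :
    ((∀ c ∈ Subalgebra.centralizer ℚ (H.endAlg : Set (Module.End ℚ V)), ∀ x y,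
        B (c.baseChange K x) y = B x ((Q.adjoint c).baseChange K y)) ∧
        ∀ x y, B y x = (((n.negOnePow : ℤˣ) : ℤ) : K) * B x y) ↔
      ∃ β ∈ Submodule.span K (Set.range fun a : H.endAlg ↦ (a : Module.End ℚ V).baseChange K),
        Q.adjointBaseChange K β = β ∧ ∀ x y, B x y = Q.form.baseChange K (β x) y := by
  obtain ⟨β, hβ, huniq⟩ := Q.existsUnique_baseChange_form_comp K B
  rw [Q.forall_centralizer_baseChange_form_apply_adjoint_iff_mem_span K hβ,
    Q.forall_baseChange_form_swap_iff_adjointBaseChange_eq_self K hβ]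
  refine ⟨fun h ↦ ⟨β, h.1, h.2, hβ⟩, fun ⟨β', hβ', hadj, h'⟩ ↦ ?_⟩
  obtain rfl : β' = β := huniq β' h'
  exact ⟨hβ', hadj⟩

end Parity

end HodgeStructure

end Literature.AlgebraicGeometry.Motives

end
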